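import Mathlib.AlgebraicGeometry.IdealSheaf.Basic
import Mathlib.AlgebraicGeometry.Noetherian
import HarnessLib

/-!
# [OURS · L1 W4.5a] N1 `IdealSheafOfClosedCurve` — the level-2 centre of the two-level tower as an ideal sheaf:
# `J₂ := 𝓘(C̄)` (Mathlib `Scheme.IdealSheafData.vanishingIdeal`), its chart description by the prime cutting out `C̄ ∩ U`,
# and the three hypotheses 5h `pointFixable_of_goodTower` consumes (`J₂.ideal U` f.g., `J₂ ≠ ⊥`, `supp J₂ ⊆ π₁⁻¹{b}`)

Crux `FrobeniusLadder.FInjectiveMacaulayfication` = stmt-ResolutionOfSingularities-15315 (chain w45a), hole #4 / 5e tower format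
(lead-1's E7 «two-level format engine», scoping memo `L/res-L1-w45a-lead-1/E7-SCOPING.md` 04c7249e4caa397e §2 **N1**; res-L1-w45a-plan-1
RULING R12.40 (b) 2026-08-27T10:06:13Z «N1 `IdealSheafOfClosedCurve` (S) — OFFER → res-type-034»). Helper `--supports
stmt-ResolutionOfSingularities-15315 --as helper`, typed by res-type-034. OURS: replaces the role of NOTHING in H. Hironaka's
manuscript and is NOT a statement of it; AI-written kernel lemmas of the cell `res-hironaka`, weaker than expert review. NO
definition is declared: `J₂` IS Mathlib's `Scheme.IdealSheafData.vanishingIdeal ⟨C̄, hC̄⟩` (the largest ideal sheaf with support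
`C̄`; the reduced induced structure), used BY NAME.

THE POINT (memo §2 N1, strat-1 T11-P3-TOWER §3 T-a): the level-2 centre of the tower is the CLOSED CURVE `C̄ ⊆ π₁⁻¹{b}` (the closure
of the translated coordinate line of the exceptional divisor), and «no gluing datum is ever written: the two chart descriptions
AGREE because both are THE radical ideal of the same closed set». Typed:
* `ideal_vanishingIdeal_eq_of_preimage_eq_zeroLocus` — for an affine open `U` and a PRIME `P ⊆ Γ(X, U)` whose zero locus is
  `C̄ ∩ U` read in the chart (`U.fromSpec ⁻¹' C̄ = V(P)` in `Spec Γ(X, U)`): **`(𝓘(C̄)).ideal U = P`** (Mathlib `vanishingIdeal_ideal`: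
  the sections ideal is the vanishing ideal of the preimage; `PrimeSpectrum.vanishingIdeal_zeroLocus_eq_radical`; `√P = P`);
  the RADICAL-ideal form `ideal_vanishingIdeal_eq_radical_of_preimage_eq_zeroLocus` (any ideal `I`: `= √I`); and the PRESENTED form
  `map_ideal_vanishingIdeal_eq_of_preimage_eq_zeroLocus` — with `e : Γ(X, U) ≃+* R` and a prime `P ⊆ R` cutting out `C̄ ∩ U`
  (`U.fromSpec ⁻¹' C̄ = V(e⁻¹P)`), `((𝓘(C̄)).ideal U).map e = P` (the memo's «`(J₂.ideal U).map e = P`»).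
* `ideal_vanishingIdeal_eq_top_of_preimage_eq_empty` / `…_of_disjoint` — off the curve the chart ideal is `⊤` («`J₂.ideal U = ⊤` when
  `C̄ ∩ U = ∅`»: the 85 of 87 charts of T₁₁/3 off the level-2 centre).
* The three 5h hypotheses: `fg_ideal_vanishingIdeal` (`X` locally Noetherian ⇒ `(J₂.ideal U).FG` for every affine `U`),
  `vanishingIdeal_ne_bot_of_ne_univ` (`C̄ ≠ X` ⇒ `J₂ ≠ ⊥`, since `supp ⊥ = X`), `coe_support_vanishingIdeal_subset` (`supp J₂ = C̄ ⊆ W`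
  for any `W ⊇ C̄`, e.g. `W = π₁⁻¹{b}`), bundled as `vanishingIdeal_towerHypotheses` in the binder shapes of
  `PointFixableOfGoodTower.pointFixable_of_goodTower` (p512998 l.55: `(∀ U : X'.affineOpens, (J₂.ideal U).FG) → J₂ ≠ ⊥ →
  (J₂.support : Set X') ⊆ π₁.base ⁻¹' {b}`).
* (rev 2, res-L1-w45a-lead-1 ANSWER 10:15:19Z) the `e`-FREE chart form in the tree's `primeIdealOf` currency:
  `ideal_vanishingIdeal_eq_of_forall_primeIdealOf_iff` — `(∀ x ∈ U, I ≤ 𝔭_x ↔ x ∈ C̄) → (𝓘(C̄)).ideal U = I` for `I` prime (radical form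
  for any `I`; `map` form along `e`), via `preimage_fromSpec_eq_zeroLocus_of_forall_iff`, `primeIdealOf_fromSpec`, `fromSpec_mem`.
References: Mathlib `AlgebraicGeometry.IdealSheaf.Basic` (`vanishingIdeal`, `vanishingIdeal_ideal`, `coe_support_vanishingIdeal`,
`support_bot`), `IsAffineOpen.fromSpec_primeIdealOf`; The Stacks Project, Tag 01J3 (reduced induced closed subscheme) — background only.
-/

noncomputable section

set_option linter.dupNamespace false -- mandated namespace `Summit.<Summit>.<Problem>` of this single-conjunct summit

namespace Summit.ResolutionOfSingularities.ResolutionOfSingularities.Theorems.FInjectiveMacaulayfication.IdealSheafOfClosedCurve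

open CategoryTheory AlgebraicGeometry TopologicalSpace PrimeSpectrum

universe u

variable {X : Scheme.{u}}

/-! ## The chart description: on an affine open the ideal of `𝓘(C̄)` is the radical ideal cutting out `C̄ ∩ U` -/

/-- **Radical form.** For a closed `Z ⊆ X`, an affine open `U` and ANY ideal `I ⊆ Γ(X, U)` whose zero locus in `Spec Γ(X, U)` is
the chart preimage of `Z`: `(𝓘(Z)).ideal U = √I`. [folklore; Mathlib `vanishingIdeal_ideal` + `vanishingIdeal_zeroLocus_eq_radical`] -/
theorem ideal_vanishingIdeal_eq_radical_of_preimage_eq_zeroLocus (Z : Closeds X) (U : X.affineOpens) (I : Ideal Γ(X, U))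
    (hI : U.2.fromSpec ⁻¹' (Z : Set X) = zeroLocus (I : Set Γ(X, U))) :
    (Scheme.IdealSheafData.vanishingIdeal Z).ideal U = I.radical := by
  rw [Scheme.IdealSheafData.vanishingIdeal_ideal]
  -- the chart preimage IS `V(I)` (as a set of primes of `Γ(X, U)`)
  have key : ∀ S : Set (PrimeSpectrum Γ(X, U)), S = zeroLocus (I : Set Γ(X, U)) → vanishingIdeal S = I.radical := by
    rintro S rfl
    exact vanishingIdeal_zeroLocus_eq_radical I
  exact key _ hI

/-- **N1, chart form: where a PRIME `P` cuts out `C̄ ∩ U`, `J₂.ideal U = P`.** For a closed `Z ⊆ X` (the curve `C̄`), an affine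
open `U` and a prime `P ⊆ Γ(X, U)` with `U.fromSpec ⁻¹' Z = V(P)`: `(𝓘(Z)).ideal U = P`. [folklore; E7-SCOPING §2 N1] -/
theorem ideal_vanishingIdeal_eq_of_preimage_eq_zeroLocus (Z : Closeds X) (U : X.affineOpens) (P : Ideal Γ(X, U)) [P.IsPrime]
    (hP : U.2.fromSpec ⁻¹' (Z : Set X) = zeroLocus (P : Set Γ(X, U))) :
    (Scheme.IdealSheafData.vanishingIdeal Z).ideal U = P := by
  rw [ideal_vanishingIdeal_eq_radical_of_preimage_eq_zeroLocus Z U P hP, Ideal.IsPrime.radical ‹_›]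

/-- **N1, presented chart form (the memo's «`(J₂.ideal U).map e = P`»).** With a presentation `e : Γ(X, U) ≃+* R` of the affine
open and a prime `P ⊆ R` whose zero locus, read through `e`, is the chart preimage of `Z` (`U.fromSpec ⁻¹' Z = V(e⁻¹ P)`):
`((𝓘(Z)).ideal U).map e = P`. [folklore; E7-SCOPING §2 N1] -/
theorem map_ideal_vanishingIdeal_eq_of_preimage_eq_zeroLocus (Z : Closeds X) (U : X.affineOpens) {R : Type u} [CommRing R]
    (e : Γ(X, U) ≃+* R) (P : Ideal R) [P.IsPrime]
    (hP : U.2.fromSpec ⁻¹' (Z : Set X) = zeroLocus ((P.comap e : Ideal Γ(X, U)) : Set Γ(X, U))) :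
    ((Scheme.IdealSheafData.vanishingIdeal Z).ideal U).map e = P := by
  haveI : (P.comap e).IsPrime := Ideal.IsPrime.comap _
  rw [ideal_vanishingIdeal_eq_of_preimage_eq_zeroLocus Z U (P.comap e) hP]
  exact Ideal.map_comap_of_surjective e e.surjective P

/-! ## Off the curve the chart ideal is the unit ideal -/

/-- **`J₂.ideal U = ⊤` when `C̄ ∩ U = ∅`** (chart preimage empty). [folklore; E7-SCOPING §2 N1] -/
theorem ideal_vanishingIdeal_eq_top_of_preimage_eq_empty (Z : Closeds X) (U : X.affineOpens)
    (h : U.2.fromSpec ⁻¹' (Z : Set X) = ∅) :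
    (Scheme.IdealSheafData.vanishingIdeal Z).ideal U = ⊤ := by
  rw [Scheme.IdealSheafData.vanishingIdeal_ideal]
  have key : ∀ S : Set (PrimeSpectrum Γ(X, U)), S = ∅ → vanishingIdeal S = ⊤ := by
    rintro S rfl
    exact (PrimeSpectrum.gc Γ(X, U)).u_top
  exact key _ h

/-- The same from `Z ∩ U = ∅` stated in `X` (the range of `U.fromSpec` is `U`). [folklore] -/
theorem ideal_vanishingIdeal_eq_top_of_disjoint (Z : Closeds X) (U : X.affineOpens)
    (h : (Z : Set X) ∩ (U : Set X) = ∅) :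
    (Scheme.IdealSheafData.vanishingIdeal Z).ideal U = ⊤ := by
  refine ideal_vanishingIdeal_eq_top_of_preimage_eq_empty Z U (Set.eq_empty_iff_forall_notMem.mpr fun x hx => ?_)
  have hxU : U.2.fromSpec x ∈ (U : Set X) := by
    rw [← U.2.range_fromSpec]
    exact Set.mem_range_self x
  exact (Set.eq_empty_iff_forall_notMem.mp h) (U.2.fromSpec x) ⟨hx, hxU⟩

/-! ## The three hypotheses of 5h `pointFixable_of_goodTower` for `J₂ = 𝓘(C̄)` -/

/-- **`(J₂.ideal U).FG`** for every affine open `U` of a locally Noetherian `X` (sections over affine opens are Noetherian rings).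
[folklore] -/
theorem fg_ideal_vanishingIdeal [IsLocallyNoetherian X] (Z : Closeds X) (U : X.affineOpens) :
    ((Scheme.IdealSheafData.vanishingIdeal Z).ideal U).FG := by
  haveI : IsNoetherianRing Γ(X, U) := IsLocallyNoetherian.component_noetherian U
  exact IsNoetherian.noetherian _

/-- **`J₂ ≠ ⊥`** as soon as `Z` is not the whole space: `supp 𝓘(Z) = Z` while `supp ⊥ = X`. [folklore] -/
theorem vanishingIdeal_ne_bot_of_ne_univ (Z : Closeds X) (hZ : (Z : Set X) ≠ Set.univ) :
    Scheme.IdealSheafData.vanishingIdeal Z ≠ ⊥ := by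
  intro h
  apply hZ
  have hs := congrArg (fun I : X.IdealSheafData => (I.support : Set X)) h
  simp only [Scheme.IdealSheafData.coe_support_vanishingIdeal, Scheme.IdealSheafData.support_bot, Closeds.coe_top] at hs
  exact hs

/-- **`supp J₂ = Z ⊆ W`** for any `W ⊇ Z` (e.g. `W = π₁⁻¹{b}`: the curve lies in the exceptional fibre). [folklore] -/
theorem coe_support_vanishingIdeal_subset (Z : Closeds X) {W : Set X} (hZW : (Z : Set X) ⊆ W) :
    ((Scheme.IdealSheafData.vanishingIdeal Z).support : Set X) ⊆ W := by
  rw [Scheme.IdealSheafData.coe_support_vanishingIdeal]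
  exact hZW

/-- **The three 5h hypotheses, bundled** in the binder shapes of `PointFixableOfGoodTower.pointFixable_of_goodTower` (p512998): for
`X'` locally Noetherian, `π₁ : X' ⟶ X`, `b : X` and a closed `C̄ ⊆ π₁⁻¹{b}` which is not all of `X'`, the ideal sheaf `J₂ := 𝓘(C̄)`
satisfies `(∀ U, (J₂.ideal U).FG) ∧ J₂ ≠ ⊥ ∧ supp J₂ ⊆ π₁⁻¹{b}`. [folklore; E7-SCOPING §2 N1/N4] -/
theorem vanishingIdeal_towerHypotheses {X X' : Scheme.{u}} [IsLocallyNoetherian X'] (π₁ : X' ⟶ X) (b : X)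
    (C : Set X') (hC : IsClosed C) (hCb : C ⊆ π₁.base ⁻¹' {b}) (hCne : C ≠ Set.univ) :
    (∀ U : X'.affineOpens, ((Scheme.IdealSheafData.vanishingIdeal (⟨C, hC⟩ : Closeds X')).ideal U).FG) ∧
      Scheme.IdealSheafData.vanishingIdeal (⟨C, hC⟩ : Closeds X') ≠ ⊥ ∧
      ((Scheme.IdealSheafData.vanishingIdeal (⟨C, hC⟩ : Closeds X')).support : Set X') ⊆ π₁.base ⁻¹' {b} :=
  ⟨fun U => fg_ideal_vanishingIdeal _ U, vanishingIdeal_ne_bot_of_ne_univ _ hCne,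
    coe_support_vanishingIdeal_subset _ hCb⟩

/-! ## rev 2 (append-only): the chart lemma `e`-FREE in the tree's `primeIdealOf` currency (res-L1-w45a-lead-1 ANSWER 10:15:19Z)

The P_cert / P_locα files (`CertifiedChartCentre`, `LocallyFixable`, `PointFixableCentre.under_le_primeIdealOf_iff` p511156) describe
the zero locus of a chart ideal `I ⊆ Γ(X, U)` pointwise by «`I ≤ 𝔭_x ↔ x ∈ C̄`» with `𝔭_x = (U.2.primeIdealOf ⟨x, hx⟩).asIdeal`; the
lemmas below accept exactly that and return `(𝓘(C̄)).ideal U = I` (then the consumer pushes along its own `e : Γ(X, U) ≃+* R`). -/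

/-- A chart point lies in the chart: `U.fromSpec p ∈ U` (the range of `fromSpec` is `U`). [folklore; Mathlib
`IsAffineOpen.range_fromSpec`] -/
theorem fromSpec_mem (U : X.affineOpens) (p : PrimeSpectrum Γ(X, U)) : U.2.fromSpec p ∈ (U : X.Opens) := by
  rw [← SetLike.mem_coe, ← U.2.range_fromSpec]
  exact ⟨p, rfl⟩

/-- The chart point of `fromSpec p` is `p` (`fromSpec` is injective and `fromSpec (primeIdealOf x) = x`). [folklore; Mathlib
`IsAffineOpen.fromSpec_primeIdealOf`] -/
theorem primeIdealOf_fromSpec (U : X.affineOpens) (p : PrimeSpectrum Γ(X, U)) (hp : U.2.fromSpec p ∈ (U : X.Opens)) :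
    U.2.primeIdealOf ⟨U.2.fromSpec p, hp⟩ = p :=
  U.2.fromSpec.isOpenEmbedding.injective (U.2.fromSpec_primeIdealOf _)

/-- **Pointwise zero-locus description ⇒ chart preimage = `V(I)`.** If `I ≤ 𝔭_x ↔ x ∈ Z` for every point `x` of the affine open
`U`, then `U.fromSpec ⁻¹' Z = V(I)` in `Spec Γ(X, U)`. [folklore] -/
theorem preimage_fromSpec_eq_zeroLocus_of_forall_iff (Z : Closeds X) (U : X.affineOpens) (I : Ideal Γ(X, U))
    (hI : ∀ (x : X) (hx : x ∈ (U : X.Opens)), I ≤ (U.2.primeIdealOf ⟨x, hx⟩).asIdeal ↔ x ∈ (Z : Set X)) :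
    U.2.fromSpec ⁻¹' (Z : Set X) = zeroLocus (I : Set Γ(X, U)) := by
  ext p
  have key : U.2.fromSpec p ∈ (Z : Set X) ↔ I ≤ (p : PrimeSpectrum Γ(X, U)).asIdeal := by
    rw [← hI (U.2.fromSpec p) (fromSpec_mem U p), primeIdealOf_fromSpec U p (fromSpec_mem U p)]
  exact key

/-- **N1, `e`-free chart form (res-L1-w45a-lead-1's preferred binder shape).** For a closed `Z ⊆ X` (the curve `C̄`), an affine open
`U` and a PRIME `I ⊆ Γ(X, U)` with `∀ x ∈ U, I ≤ 𝔭_x ↔ x ∈ Z`: `(𝓘(Z)).ideal U = I`. [folklore; E7-SCOPING §2 N1] -/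
theorem ideal_vanishingIdeal_eq_of_forall_primeIdealOf_iff (Z : Closeds X) (U : X.affineOpens) (I : Ideal Γ(X, U)) [I.IsPrime]
    (hI : ∀ (x : X) (hx : x ∈ (U : X.Opens)), I ≤ (U.2.primeIdealOf ⟨x, hx⟩).asIdeal ↔ x ∈ (Z : Set X)) :
    (Scheme.IdealSheafData.vanishingIdeal Z).ideal U = I :=
  ideal_vanishingIdeal_eq_of_preimage_eq_zeroLocus Z U I (preimage_fromSpec_eq_zeroLocus_of_forall_iff Z U I hI)

/-- The radical form of the same (any ideal `I`, no primality): `(𝓘(Z)).ideal U = √I`. [folklore] -/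
theorem ideal_vanishingIdeal_eq_radical_of_forall_primeIdealOf_iff (Z : Closeds X) (U : X.affineOpens) (I : Ideal Γ(X, U))
    (hI : ∀ (x : X) (hx : x ∈ (U : X.Opens)), I ≤ (U.2.primeIdealOf ⟨x, hx⟩).asIdeal ↔ x ∈ (Z : Set X)) :
    (Scheme.IdealSheafData.vanishingIdeal Z).ideal U = I.radical :=
  ideal_vanishingIdeal_eq_radical_of_preimage_eq_zeroLocus Z U I (preimage_fromSpec_eq_zeroLocus_of_forall_iff Z U I hI)

/-- And pushed along a presentation `e : Γ(X, U) ≃+* R` (what N2/N4 consume at `R`-level): `((𝓘(Z)).ideal U).map e = I.map e`, the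
latter a PRIME of `R`. [folklore] -/
theorem map_ideal_vanishingIdeal_eq_of_forall_primeIdealOf_iff (Z : Closeds X) (U : X.affineOpens) (I : Ideal Γ(X, U)) [I.IsPrime]
    (hI : ∀ (x : X) (hx : x ∈ (U : X.Opens)), I ≤ (U.2.primeIdealOf ⟨x, hx⟩).asIdeal ↔ x ∈ (Z : Set X))
    {R : Type u} [CommRing R] (e : Γ(X, U) ≃+* R) :
    ((Scheme.IdealSheafData.vanishingIdeal Z).ideal U).map e = I.map e ∧ (I.map e).IsPrime := by
  rw [ideal_vanishingIdeal_eq_of_forall_primeIdealOf_iff Z U I hI]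
  exact ⟨rfl, Ideal.map_isPrime_of_equiv e⟩

end Summit.ResolutionOfSingularities.ResolutionOfSingularities.Theorems.FInjectiveMacaulayfication.IdealSheafOfClosedCurve

end
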